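import Summits.QuantumFields.YangMills.Theorems.BalabanUVNodesN12ChartCurvatureOfClass
import Literature.MathematicalPhysics.QuantumFieldTheory.Balaban1983to89.Node00.MultiScaleFibreChartLocalityComponent

/-!
# DAG node N12 [B15] — THE ℓ¹-CURVATURE LETTER OF THE DIRECT ROAD WITH A PER-HEIGHT CONSTANT: component locality of the multi-scale chart in the chart variable, the
# component-local curvature bound at a near-flat core, and its transport to a (2.12) minimiser through the class (uniformity pen ρ7, census §7 U2b; inhabits ρ6's `hM₂1`)

[Balaban1985Variational] = «[15]», Sect. C (44)–(48) p. 285, (81)–(83) p. 290; [Balaban1988Convergent] = «[III]», (2.2) p. 255, (2.10)–(2.13) pp. 256–257;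
[Balaban1989LargeFieldII] = «[LF-II]», (1.12)–(1.13) p. 359.

Cell `pub-ymgap`, HUMAN RULINGS D-0062 ∕ D-0149, lane owner `pub-ymgap-dag-n12-c` (g22).  Key K1⁹ `stmt-QuantumFields-27364`, `--kind proof --supports … --as helper`; count-neutral.
NEW leaf; CONSUMED BY NAME, nothing modified: this lane's `N12ChartCurvatureOfClass` (ρ5d p679666: `towerGauges_Bj_of_mem_class`, `msChart_gaugeAct_apply`, `fderiv_fderiv_conj_apply`,
`gaugeAct_gaugeAct_inv`), `N12ChartRegularityTowerProxies.msChart_component_eq_of_towerProxy` (ρ5a), `N12TowerProxiesOfClass.chartLetters_msChart_Bj_of_isMinimizer_of_class` (ρ5b),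
`Node00.fderiv_fderiv_apply_pi` ∕ `regularity_binders_msChart` ∕ `contDiffAt_msChart` ∕ `msChart_apply_congr_of_eqOn_feeds_right` (dag-n12-w4 ∕ n07-e; `Node00/MultiScaleFibreChartLocalityComponent`),
`B14.Eq216Concrete.feeds` (r12).

WHY (census `N12-DIRECT-ROW-CENSUS-2026-08-28.md` §7 U2b; memo `N12-UNIFORMITY-SPEC.md`).  ρ6 (`N12DirectChartPackageOfClassL1`) displays the chart curvature of the (μ) row through
the ℓ¹-CURVATURE LETTER `hM₂1 : Σ_c ‖D²Ψ_{U₀}(0)(w,w)_c‖ ≤ M₂′·Σ_b ‖w_b‖²`; its inhabitant of record from the sup-curvature letter carries the constraint count `#constraints·M₂`.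
THIS FILE gives the inhabitant with a PER-HEIGHT factor instead: the `(j,c)`-component of the chart `Ψ(X) = (π log(W_j(c)*·Ū^j(U·e^X)(c)))_{(j,c)}` depends on `X` only on the fine
bonds `feeds j c` (dag-n12-w4's `msChart_apply_congr_of_eqOn_feeds_right`, from r12's `iter_local`), so `D²Ψ(0)(w,w)_{(j,c)} = D²Ψ(0)(1_{feeds}w, 1_{feeds}w)_{(j,c)}` and the sup-curvature bound `M₂‖1_{feeds}w‖²_∞ ≤
M₂·Σ_{b ∈ feeds j c} ‖w_b‖²` localises each component; summing, every fine bond is counted once per constrained bond it feeds — at most `ovl := max_b #{(j,c) : b ∈ feeds j c}`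
times, a LOCAL count, bounded in closed form by `Σ_{j ≤ k} (2d)^j` (§5: at most `2d` bonds share an endpoint, induction over `feeds`) — a PER-HEIGHT number.  The transport from a near-flat core to the (2.12) minimiser is
ρ5d's per-component gauge covariance (one tower gauge per constrained bond; `Ad` is a bondwise isometry, so `Σ_{b ∈ feeds} ‖(𝒜w)_b‖² = Σ_{b ∈ feeds} ‖w_b‖²`).

CONTENTS (namespace `Summit.QuantumFields.YangMills.BalabanUVNodes.N12ChartCurvatureL1OfClass`; theorems only — no `def`, no `instance`, no `sorry`).
* §1 `norm_indicator_sq_le_sum_sq` (`‖1_S w‖²_∞ ≤ Σ_{b ∈ S} ‖w_b‖²`); component locality in `X` is dag-n12-w4's `Node00.msChart_apply_congr_of_eqOn_feeds_right` (cited, not restated).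
* §2 `fderiv_fderiv_apply_eq_of_comp_right` — `D²g(0)(w,w) = D²g(0)(πw,πw)` for `g = g ∘ π`, `π` continuous linear, `g` `C²` at `0` [folklore].
* §3 ★★ `norm_fderiv_fderiv_msChart_apply_le_local` — at a GUARDED base field in the fibre with the sup-curvature bound `‖D²Ψ(0)(w,w)‖ ≤ M₂‖w‖²` for all `w`:
  `‖D²Ψ(0)(w,w)_{(j,c)}‖ ≤ M₂·Σ_{b ∈ feeds j c} ‖w_b‖²`.
* §4 ★★★ `sum_norm_fderiv_fderiv_msChart_apply_le_of_class` — ρ6's letter `hM₂1` at a (2.12) minimiser from the class (ρ5d's displayed rows VERBATIM: `k+1 ≤ m+K`, `4L ≤ M₁`, cube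
  divisibility, `0 ≤ εreg`, `hsbU`, `hcurv`, the floor `6(d−1)L·εreg ≤ ρ″`) plus the local-count letter `hovl`: `Σ_i ‖D²Ψ_{U₀}(0)(w,w)_i‖ ≤ (ovl·M₂)·Σ_b ‖w_b‖²`; `hovl_trivial`.
* §5 `card_filter_src_eq_or_tgt_eq_le` (≤ `2d` bonds at a site), ★ `card_filter_mem_feeds_le` (a fine bond feeds ≤ `(2d)^j` level-`j` bonds), ★★ `hovl_geometric` — the letter `hovl`
  inhabited at `ovl := Σ_{j ≤ k} (2d)^j` for EVERY determining set: per height, torus-free.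

HONEST FRAMING ∕ LOCATED.  Kernel calculus + lattice bookkeeping over landed modules; `M₂`, `ρ″` stay ∃-constants per height `(F, K, k)` (compactness over the torus's field space —
census U4, NOT print's numbers); `ovl = Σ_{j ≤ k} (2d)^j` is per height but not print's `O(1)` bookkeeping of (1.12); nothing of Bałaban's asserted; count-neutral
helper; N12 NOT discharged; K1⁹ NOT closed; counts unmoved; one finite 𝕋⁴ programme at fixed ε — R4 closes the conditional finite-𝕋⁴ rung `BalabanLadder.UV` only; NOT continuum ∕ OS ∕
mass gap ∕ Clay.
-/

noncomputable section

open scoped BigOperators Matrix.Norms.L2Operator Topology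
open Filter Finset

namespace Summit.QuantumFields.YangMills.BalabanUVNodes.N12ChartCurvatureL1OfClass

open Literature.MathematicalPhysics.QuantumFieldTheory.Balaban1983to89
open T4Continuum (T4Family)
open T4AdjointCovarianceUnitary (lieSU specialUnitaryAd coe_specialUnitaryAd norm_specialUnitaryAd)
open B15DeterminingSets
open B14.Eq213MaximalDomains (side)
open B14.Eq213DetSet (Bj Bj_of_gt maxDomT)
open B14.Eq216Concrete (feeds feeds_zero mem_feeds_succ)
open B16Sect1Backgrounds (toMS iter_gaugeAct)
open Node00
open MatrixLog (mlog)
open Summit.QuantumFields.YangMills.BalabanUVNodes.N12ChartRegularityTowerProxies (msChart_component_eq_of_towerProxy)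
open Summit.QuantumFields.YangMills.BalabanUVNodes.N12TowerProxiesOfClass (chartLetters_msChart_Bj_of_isMinimizer_of_class)
open Summit.QuantumFields.YangMills.BalabanUVNodes.N12ChartCurvatureOfClass (towerGauges_Bj_of_mem_class msChart_gaugeAct_apply fderiv_fderiv_conj_apply gaugeAct_gaugeAct_inv)

variable {F : T4Family} {N : ℕ} [NeZero N] {K k : ℕ}

/-! ## §1  The truncation of a bond field to a finite bond set -/

section Locality

/-- `‖1_S w‖²_∞ ≤ Σ_{b ∈ S} ‖w_b‖²` for the truncation of a bond field to a finite bond set `S`. [cite: Balaban1985Averaging, (17)–(19) pp.20–21 (bookkeeping)] -/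
theorem norm_indicator_sq_le_sum_sq {ι : Type*} [Fintype ι] [DecidableEq ι] {E : Type*} [SeminormedAddCommGroup E] (S : Finset ι) (w : ι → E) :
    ‖(fun b => if b ∈ S then w b else 0)‖ ^ 2 ≤ ∑ b ∈ S, ‖w b‖ ^ 2 := by
  have h0 : 0 ≤ ∑ b ∈ S, ‖w b‖ ^ 2 := Finset.sum_nonneg fun b _ => sq_nonneg _
  have h : ‖(fun b => if b ∈ S then w b else 0)‖ ≤ Real.sqrt (∑ b ∈ S, ‖w b‖ ^ 2) := by
    refine (pi_norm_le_iff_of_nonneg (Real.sqrt_nonneg _)).2 fun b => ?_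
    by_cases hb : b ∈ S
    · rw [if_pos hb]
      exact Real.le_sqrt_of_sq_le (Finset.single_le_sum (f := fun b => ‖w b‖ ^ 2) (fun b _ => sq_nonneg _) hb)
    · rw [if_neg hb, norm_zero]; exact Real.sqrt_nonneg _
  calc ‖(fun b => if b ∈ S then w b else 0)‖ ^ 2 ≤ Real.sqrt (∑ b ∈ S, ‖w b‖ ^ 2) ^ 2 := pow_le_pow_left₀ (norm_nonneg _) h 2
    _ = ∑ b ∈ S, ‖w b‖ ^ 2 := Real.sq_sqrt h0

end Locality

/-! ## §2  Second derivatives of a function factoring through a continuous linear map -/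

section Calculus

/-- ★ **`D²g(0)(w,w) = D²g(0)(πw, πw)` WHEN `g = g ∘ π`** for a continuous linear `π` and `g` of class `C²` at `0` (iterated derivative of a right composition with a continuous
linear map, on an open neighbourhood where `g` is `C²`). [folklore] -/
theorem fderiv_fderiv_apply_eq_of_comp_right {E₁ F₁ : Type*} [NormedAddCommGroup E₁] [NormedSpace ℝ E₁] [NormedAddCommGroup F₁] [NormedSpace ℝ F₁]
    (π : E₁ →L[ℝ] E₁) {g : E₁ → F₁} (hg : ContDiffAt ℝ 2 g 0) (hgl : ∀ X, g (π X) = g X) (w : E₁) :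
    fderiv ℝ (fderiv ℝ g) 0 w w = fderiv ℝ (fderiv ℝ g) 0 (π w) (π w) := by
  obtain ⟨u, hu, h0u, hgu⟩ := hg.contDiffOn' (m := 2) le_rfl (by simp)
  have hgu' : ContDiffOn ℝ 2 g u := by rwa [Set.insert_eq_of_mem (Set.mem_univ _), Set.univ_inter] at hgu
  have hπ0 : π 0 ∈ u := by rw [map_zero]; exact h0u
  have hpre : IsOpen (π ⁻¹' u) := hu.preimage π.continuous
  have key := π.iteratedFDerivWithin_comp_right (f := g) hgu' hu.uniqueDiffOn hpre.uniqueDiffOn (x := 0) hπ0 (i := 2) le_rfl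
  have hcomp : g ∘ π = g := funext fun X => hgl X
  rw [hcomp] at key
  have hL : iteratedFDerivWithin ℝ 2 g (π ⁻¹' u) 0 = iteratedFDeriv ℝ 2 g 0 := iteratedFDerivWithin_eq_iteratedFDeriv hpre.uniqueDiffOn hg hπ0
  have hR : iteratedFDerivWithin ℝ 2 g u (π 0) = iteratedFDeriv ℝ 2 g 0 := by
    rw [map_zero]; exact iteratedFDerivWithin_eq_iteratedFDeriv hu.uniqueDiffOn hg h0u
  rw [hL, hR] at key
  have h3 : fderiv ℝ (fderiv ℝ g) 0 w w = iteratedFDeriv ℝ 2 g 0 ![w, w] := by rw [iteratedFDeriv_two_apply]; rfl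
  have h4 : fderiv ℝ (fderiv ℝ g) 0 (π w) (π w) = iteratedFDeriv ℝ 2 g 0 ![π w, π w] := by rw [iteratedFDeriv_two_apply]; rfl
  rw [h3, h4]
  conv_lhs => rw [key]
  rw [ContinuousMultilinearMap.compContinuousLinearMap_apply]
  congr 1
  funext j
  fin_cases j <;> simp

end Calculus

/-! ## §3  The component-local curvature bound at a guarded base field -/

section Local

variable {𝔹 : DetSet (F.P K)} {W : MSField (F.P K) (SU N)} {V : GaugeField (F.P K) 0 (SU N)}

/-- ★★ **THE COMPONENT-LOCAL CURVATURE BOUND AT A GUARDED BASE FIELD**: if `V` is guarded below `k` and in the fibre of `W` on `𝐁` (so the chart is `C^∞` at `0`), and the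
sup-curvature bound `‖D²Ψ_V(0)(w,w)‖ ≤ M₂‖w‖²` holds for every `w` (`Node00.exists_uniform_chartCurvature_sq_bound` at a `ρ″`-near-flat `V`), then each component is controlled by
the chart variable ON ITS OWN FEEDING BONDS: `‖D²Ψ_V(0)(w,w)_{(j,c)}‖ ≤ M₂·Σ_{b ∈ feeds j c} ‖w_b‖²` (§1 locality + §2 at the truncation `1_{feeds j c}`).
[cite: Balaban1985Variational, Sect. C (47) p.285, (81)–(83) p.290; Balaban1988Convergent, (2.10)–(2.11) p.256; Balaban1989LargeFieldII, (1.12) p.359] -/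
theorem norm_fderiv_fderiv_msChart_apply_le_local (hk : k ≤ (F.P K).m + (F.P K).K) (hfib : AgreeOn 𝔹 (avgFamily (avOfRecord F N K) V) W)
    (hsb : SmallBelow (avOfRecord F N K) k V) {M₂ : ℝ} (hM₂ : 0 ≤ M₂)
    (hcurv : ∀ w : PBond (F.P K) 0 → lieSU (Fin N), ‖fderiv ℝ (fderiv ℝ (msChart F N K k 𝔹 W V)) 0 w w‖ ≤ M₂ * ‖w‖ ^ 2)
    (i : Fin (constrCard 𝔹 k)) (S : Finset (PBond (F.P K) 0))
    (hS : ∀ b, b ∈ feeds (((constrEnum 𝔹 k).symm i).1 : ℕ) ((constrEnum 𝔹 k).symm i).2.1 → b ∈ S) (w : PBond (F.P K) 0 → lieSU (Fin N)) :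
    ‖fderiv ℝ (fderiv ℝ (msChart F N K k 𝔹 W V)) 0 w w i‖ ≤ M₂ * ∑ b ∈ S, ‖w b‖ ^ 2 := by
  classical
  -- the truncation to `S` as a continuous linear map
  let π : (PBond (F.P K) 0 → lieSU (Fin N)) →L[ℝ] (PBond (F.P K) 0 → lieSU (Fin N)) :=
    ContinuousLinearMap.pi fun b => if b ∈ S then ContinuousLinearMap.proj b else 0
  have hπ : ∀ X b, π X b = if b ∈ S then X b else 0 := by
    intro X b
    simp only [π, ContinuousLinearMap.pi_apply]
    split_ifs <;> simp
  -- regularity at the guarded base field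
  obtain ⟨hΨ₂, hΨd⟩ := regularity_binders_msChart (k := k) (𝔹 := 𝔹) hfib hsb
  have hC : ContDiffAt ℝ 2 (fun X => msChart F N K k 𝔹 W V X i) 0 := (contDiffAt_pi.1 (contDiffAt_msChart (k := k) (𝔹 := 𝔹) hfib hsb) i).of_le le_top
  -- locality of the component: `Ψ(πX)_i = Ψ(X)_i`
  have hgl : ∀ X, msChart F N K k 𝔹 W V (π X) i = msChart F N K k 𝔹 W V X i := fun X =>
    msChart_apply_congr_of_eqOn_feeds_right hk i fun b hb => by rw [hπ, if_pos (hS b hb)]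
  have e1 := fderiv_fderiv_apply_pi hΨd hΨ₂.differentiableAt i w w
  have e2 := fderiv_fderiv_apply_eq_of_comp_right π hC hgl w
  have e3 := fderiv_fderiv_apply_pi hΨd hΨ₂.differentiableAt i (π w) (π w)
  have c1 : ‖fderiv ℝ (fderiv ℝ (msChart F N K k 𝔹 W V)) 0 w w i‖ = ‖fderiv ℝ (fderiv ℝ (fun X => msChart F N K k 𝔹 W V X i)) 0 (π w) (π w)‖ :=
    congrArg norm (e1.trans e2)
  have c2 : ‖fderiv ℝ (fderiv ℝ (fun X => msChart F N K k 𝔹 W V X i)) 0 (π w) (π w)‖ = ‖fderiv ℝ (fderiv ℝ (msChart F N K k 𝔹 W V)) 0 (π w) (π w) i‖ :=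
    congrArg norm e3.symm
  calc ‖fderiv ℝ (fderiv ℝ (msChart F N K k 𝔹 W V)) 0 w w i‖
      = ‖fderiv ℝ (fderiv ℝ (msChart F N K k 𝔹 W V)) 0 (π w) (π w) i‖ := c1.trans c2
    _ ≤ ‖fderiv ℝ (fderiv ℝ (msChart F N K k 𝔹 W V)) 0 (π w) (π w)‖ := norm_le_pi_norm _ i
    _ ≤ M₂ * ‖π w‖ ^ 2 := hcurv (π w)
    _ ≤ M₂ * ∑ b ∈ S, ‖w b‖ ^ 2 := by
        refine mul_le_mul_of_nonneg_left ?_ hM₂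
        have hfun : (π w : PBond (F.P K) 0 → lieSU (Fin N)) = fun b => if b ∈ S then w b else 0 := funext (hπ w)
        rw [hfun]
        exact norm_indicator_sq_le_sum_sq S w

end Local

/-! ## §4  The ℓ¹-curvature letter at a (2.12) minimiser, from the class -/

section OfClass

set_option maxHeartbeats 400000 in
/-- ★★★ **THE ℓ¹-CURVATURE LETTER `hM₂1` OF ρ6 AT A (2.12) MINIMISER, WITH A LOCAL-COUNT FACTOR** — `N12ChartCurvatureOfClass.norm_fderiv_fderiv_msChart_le_of_class` (ρ5d)'s displayed
rows VERBATIM (`k+1 ≤ m+K`, `4L ≤ M₁`, the cube divisibility, `0 ≤ εreg`, the per-height letters `hsbU` ∕ `hcurv` of `Node00.exists_uniform_chartCurvature_sq_bound k`, the floor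
`6(d−1)L·εreg ≤ ρ″`) plus ONE combinatorial letter `hovl : every fine bond feeds at most ovl constrained bonds of 𝐁_k(Z)` (a LOCAL count; trivially inhabited by `ovl := #constraints`,
per height by the block geometry), conclude `Σ_i ‖D²Ψ_{𝐁_k(Z),W,U₀}(0)(w,w)_i‖ ≤ (ovl·M₂)·Σ_b ‖w_b‖²`.  Per component: ρ5d's tower gauge and gauge covariance, then §3 at the near-flat
core in the transformed coordinate `𝒜w` (a bondwise isometry: `Σ_{b ∈ feeds} ‖(𝒜w)_b‖² = Σ_{b ∈ feeds} ‖w_b‖²`); then the double count.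
[cite: Balaban1985Variational, Sect. C (44)–(48) p.285, (81)–(83) p.290, (153) p.301; Balaban1989LargeFieldII, (1.12)–(1.13) p.359; Balaban1988Convergent, (2.10)–(2.13) pp.256–257] -/
theorem sum_norm_fderiv_fderiv_msChart_apply_le_of_class (ν : Stage7Numerics) (Kt : ℕ) {k : ℕ} (Z : Set (Site (F.P Kt) 0))
    (hkK : k + 1 ≤ (F.P Kt).m + (F.P Kt).K) (hM4 : 4 * (F.P Kt).L ≤ ν.M₁) (hdiv : side (F.P Kt).L ν.M₁ k ∣ (F.P Kt).sitesPerDir 0)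
    (hε : 0 ≤ ν.εreg) {ρ'' M₂ : ℝ} (hM₂0 : 0 ≤ M₂)
    (hsbU : ∀ V : GaugeField (F.P Kt) 0 (SU N), ‖coeField V - 1‖ ≤ ρ'' → SmallBelow (avOfRecord F N Kt) k V)
    (hcurv : ∀ (𝔹 : DetSet (F.P Kt)) (W : MSField (F.P Kt) (SU N)) (V : GaugeField (F.P Kt) 0 (SU N)),
      ‖coeField V - 1‖ ≤ ρ'' → AgreeOn 𝔹 (avgFamily (avOfRecord F N Kt) V) W →
      ∀ w : PBond (F.P Kt) 0 → lieSU (Fin N), ‖fderiv ℝ (fderiv ℝ (msChart F N Kt k 𝔹 W V)) 0 w w‖ ≤ M₂ * ‖w‖ ^ 2)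
    (hερ : 6 * ((((F.P Kt).d - 1 : ℕ)) : ℝ) * (F.P Kt).L * ν.εreg ≤ ρ'')
    -- the LOCAL COUNT letter: every fine bond feeds at most `ovl` constrained bonds of `𝐁_k(Z)`
    {ovl : ℕ} (hovl : ∀ (b : PBond (F.P Kt) 0) (s : Finset (Fin (constrCard (Bj ν.M₁ Z k) k))),
      (∀ i ∈ s, b ∈ feeds (((constrEnum (Bj ν.M₁ Z k) k).symm i).1 : ℕ) ((constrEnum (Bj ν.M₁ Z k) k).symm i).2.1) → s.card ≤ ovl)
    {W : MSField (F.P Kt) (SU N)} {U₀ : GaugeField (F.P Kt) 0 (SU N)}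
    (h : IsMinimizer (avOfRecord F N Kt) (regMSCoPOfRecord F N ν Kt k (maxDomT ν.M₁ Z)) (Bj ν.M₁ Z k) W U₀)
    (w : PBond (F.P Kt) 0 → lieSU (Fin N)) :
    ∑ i, ‖fderiv ℝ (fderiv ℝ (msChart F N Kt k (Bj ν.M₁ Z k) W U₀)) 0 w w i‖ ≤ ((ovl : ℝ) * M₂) * ∑ b, ‖w b‖ ^ 2 := by
  classical
  have hk : k ≤ (F.P Kt).m + (F.P Kt).K := by omega
  have h𝔹 : ∀ j, k < j → (Bj ν.M₁ Z k : DetSet (F.P Kt)) j = ∅ := fun _ hj => Bj_of_gt hj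
  -- regularity of the chart at `U₀` (from the class, ρ5b)
  obtain ⟨-, -, ⟨hΨ₂, hΨd⟩, -⟩ := chartLetters_msChart_Bj_of_isMinimizer_of_class ν Kt Z hkK hM4 hdiv hε hsbU hερ h
  -- the feeding sets as finite sets
  let S : Fin (constrCard (Bj ν.M₁ Z k) k) → Finset (PBond (F.P Kt) 0) := fun i =>
    Finset.univ.filter fun b => b ∈ feeds (((constrEnum (Bj ν.M₁ Z k) k).symm i).1 : ℕ) ((constrEnum (Bj ν.M₁ Z k) k).symm i).2.1
  have hS : ∀ i b, b ∈ feeds (((constrEnum (Bj ν.M₁ Z k) k).symm i).1 : ℕ) ((constrEnum (Bj ν.M₁ Z k) k).symm i).2.1 → b ∈ S i :=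
    fun i b hb => Finset.mem_filter.2 ⟨Finset.mem_univ _, hb⟩
  -- ### per component: the local bound transported through the tower gauge
  have hcomp_i : ∀ i, ‖fderiv ℝ (fderiv ℝ (msChart F N Kt k (Bj ν.M₁ Z k) W U₀)) 0 w w i‖ ≤ M₂ * ∑ b ∈ S i, ‖w b‖ ^ 2 := by
    intro i
    -- the gauge and the near-flat core of the `i`-th tower
    obtain ⟨u, V, hV, hin⟩ := towerGauges_Bj_of_mem_class ν Kt Z hkK hM4 hdiv hε h.1 i
    set U' : GaugeField (F.P Kt) 0 (SU N) := GaugeField.gaugeAct (fun s => (u s)⁻¹ : GaugeTransf (F.P Kt) 0 (SU N)) V with hU'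
    have hVρ : ‖coeField V - 1‖ ≤ ρ'' := hV.trans hερ
    have hsbV : SmallBelow (avOfRecord F N Kt) k V := hsbU V hVρ
    have huU' : GaugeField.gaugeAct u U' = V := gaugeAct_gaugeAct_inv u V
    -- the proxy chart and its `i`-th component
    set W' : MSField (F.P Kt) (SU N) := avgFamily (avOfRecord F N Kt) U' with hW'
    have hcomp := msChart_component_eq_of_towerProxy (𝔹 := Bj ν.M₁ Z k) (W := W) (U := U₀) hk h.2.1 i hin
    -- the transformed pair (`V = u•U'`, `W'^u`) and the coordinate isometry `𝒜`
    set Wu : MSField (F.P Kt) (SU N) := fun j c => toMS u j c.src * W' j c * (toMS u j c.tgt)⁻¹ with hWu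
    let 𝒜 : (PBond (F.P Kt) 0 → lieSU (Fin N)) ≃L[ℝ] (PBond (F.P Kt) 0 → lieSU (Fin N)) :=
      ContinuousLinearEquiv.piCongrRight fun b => (specialUnitaryAd (u b.tgt)).toContinuousLinearEquiv
    have h𝒜 : ∀ X b, 𝒜 X b = specialUnitaryAd (u b.tgt) (X b) := fun X b => rfl
    set bi : SU N := toMS u (((constrEnum (Bj ν.M₁ Z k) k).symm i).1 : ℕ) ((constrEnum (Bj ν.M₁ Z k) k).symm i).2.1.tgt with hbi
    let L : lieSU (Fin N) ≃L[ℝ] lieSU (Fin N) := (specialUnitaryAd bi).toContinuousLinearEquiv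
    have hcov : ∀ X, msChart F N Kt k (Bj ν.M₁ Z k) Wu V (𝒜 X) i = L (msChart F N Kt k (Bj ν.M₁ Z k) W' U' X i) := by
      intro X
      have hX : (𝒜 X : PBond (F.P Kt) 0 → lieSU (Fin N)) = fun b => specialUnitaryAd (u b.tgt) (X b) := funext (h𝒜 X)
      show msChart F N Kt k (Bj ν.M₁ Z k) Wu V (𝒜 X) i = specialUnitaryAd bi (msChart F N Kt k (Bj ν.M₁ Z k) W' U' X i)
      rw [hX, ← huU']
      exact msChart_gaugeAct_apply hk u W' U' X i
    have hconj := fderiv_fderiv_conj_apply 𝒜 L (f := fun Y => msChart F N Kt k (Bj ν.M₁ Z k) W' U' Y i)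
      (g := fun Y => msChart F N Kt k (Bj ν.M₁ Z k) Wu V Y i) hcov w
    -- the chart at `V` is regular (near-flat core) and in the fibre of `W'^u`
    have hfibV : AgreeOn (Bj ν.M₁ Z k) (avgFamily (avOfRecord F N Kt) V) Wu := by
      intro j c hc
      by_cases hj : j ≤ k
      · show Averaging.iter (avOfRecord F N Kt) j V c = _
        rw [← huU', iter_gaugeAct (avOfRecord F N Kt) u U' j (hj.trans hk)]
        rfl
      · exfalso; rw [h𝔹 j (lt_of_not_ge hj)] at hc; simp [bondsOf] at hc
    obtain ⟨hΨ₂V, hΨdV⟩ := regularity_binders_msChart (k := k) (𝔹 := Bj ν.M₁ Z k) hfibV hsbV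
    -- the component-local bound at the near-flat core, in the transformed coordinate
    have hloc : ‖fderiv ℝ (fderiv ℝ (msChart F N Kt k (Bj ν.M₁ Z k) Wu V)) 0 (𝒜 w) (𝒜 w) i‖ ≤ M₂ * ∑ b ∈ S i, ‖(𝒜 w) b‖ ^ 2 :=
      norm_fderiv_fderiv_msChart_apply_le_local hk hfibV hsbV hM₂0 (hcurv (Bj ν.M₁ Z k) Wu V hVρ hfibV) i (S i) (hS i) (𝒜 w)
    have hiso : ∑ b ∈ S i, ‖(𝒜 w) b‖ ^ 2 = ∑ b ∈ S i, ‖w b‖ ^ 2 :=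
      Finset.sum_congr rfl fun b _ => by rw [h𝒜, norm_specialUnitaryAd]
    -- assemble: component at `U₀` = component of the proxy chart = conjugate of the `V`-chart's component at `𝒜 w`
    have e1 := fderiv_fderiv_apply_pi hΨd hΨ₂.differentiableAt i w w
    have e2 : fderiv ℝ (fderiv ℝ (fun X => msChart F N Kt k (Bj ν.M₁ Z k) W U₀ X i)) 0 w w
        = fderiv ℝ (fderiv ℝ (fun X => msChart F N Kt k (Bj ν.M₁ Z k) W' U' X i)) 0 w w := by rw [hcomp]
    have e3 := fderiv_fderiv_apply_pi hΨdV hΨ₂V.differentiableAt i (𝒜 w) (𝒜 w)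
    have c1 : ‖fderiv ℝ (fderiv ℝ (msChart F N Kt k (Bj ν.M₁ Z k) W U₀)) 0 w w i‖
        = ‖fderiv ℝ (fderiv ℝ (fun X => msChart F N Kt k (Bj ν.M₁ Z k) W' U' X i)) 0 w w‖ := congrArg norm (e1.trans e2)
    have c2 : ‖fderiv ℝ (fderiv ℝ (fun X => msChart F N Kt k (Bj ν.M₁ Z k) W' U' X i)) 0 w w‖
        = ‖L (fderiv ℝ (fderiv ℝ (fun X => msChart F N Kt k (Bj ν.M₁ Z k) W' U' X i)) 0 w w)‖ := (norm_specialUnitaryAd bi _).symm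
    have c3 : ‖L (fderiv ℝ (fderiv ℝ (fun X => msChart F N Kt k (Bj ν.M₁ Z k) W' U' X i)) 0 w w)‖
        = ‖fderiv ℝ (fderiv ℝ (fun Y => msChart F N Kt k (Bj ν.M₁ Z k) Wu V Y i)) 0 (𝒜 w) (𝒜 w)‖ := congrArg norm hconj.symm
    have c4 : ‖fderiv ℝ (fderiv ℝ (fun Y => msChart F N Kt k (Bj ν.M₁ Z k) Wu V Y i)) 0 (𝒜 w) (𝒜 w)‖
        = ‖fderiv ℝ (fderiv ℝ (msChart F N Kt k (Bj ν.M₁ Z k) Wu V)) 0 (𝒜 w) (𝒜 w) i‖ := congrArg norm e3.symm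
    rw [← hiso]
    exact (c1.trans (c2.trans (c3.trans c4))).trans_le hloc
  -- ### the double count: every fine bond is counted once per constrained bond it feeds, at most `ovl` times
  have hcount : ∀ b : PBond (F.P Kt) 0, ((Finset.univ.filter fun i : Fin (constrCard (Bj ν.M₁ Z k) k) => b ∈ S i).card : ℝ) ≤ ovl := by
    intro b
    exact_mod_cast hovl b _ fun i hi => (Finset.mem_filter.1 (Finset.mem_filter.1 hi).2).2
  calc ∑ i, ‖fderiv ℝ (fderiv ℝ (msChart F N Kt k (Bj ν.M₁ Z k) W U₀)) 0 w w i‖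
      ≤ ∑ i, M₂ * ∑ b ∈ S i, ‖w b‖ ^ 2 := Finset.sum_le_sum fun i _ => hcomp_i i
    _ = M₂ * ∑ i, ∑ b ∈ S i, ‖w b‖ ^ 2 := by rw [Finset.mul_sum]
    _ = M₂ * ∑ i, ∑ b, (if b ∈ S i then ‖w b‖ ^ 2 else 0) := by
        congr 1; refine Finset.sum_congr rfl fun i _ => ?_; rw [Finset.sum_ite_mem, Finset.univ_inter]
    _ = M₂ * ∑ b, ∑ i, (if b ∈ S i then ‖w b‖ ^ 2 else 0) := by rw [Finset.sum_comm]
    _ = M₂ * ∑ b, ((Finset.univ.filter fun i : Fin (constrCard (Bj ν.M₁ Z k) k) => b ∈ S i).card : ℝ) * ‖w b‖ ^ 2 := by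
        congr 1; refine Finset.sum_congr rfl fun b _ => ?_
        rw [← Finset.sum_filter, Finset.sum_const, nsmul_eq_mul]
    _ ≤ M₂ * ∑ b, (ovl : ℝ) * ‖w b‖ ^ 2 := by
        refine mul_le_mul_of_nonneg_left (Finset.sum_le_sum fun b _ => ?_) hM₂0
        exact mul_le_mul_of_nonneg_right (hcount b) (sq_nonneg _)
    _ = ((ovl : ℝ) * M₂) * ∑ b, ‖w b‖ ^ 2 := by rw [← Finset.mul_sum]; ring

/-- The trivial inhabitant of the local-count letter: `ovl := #constraints`. [cite: Balaban1988Convergent, (2.2) p.255 (bookkeeping)] -/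
theorem hovl_trivial {P : Params} (𝔹 : DetSet P) (k : ℕ) (b : PBond P 0) (s : Finset (Fin (constrCard 𝔹 k)))
    (_h : ∀ i ∈ s, b ∈ feeds (((constrEnum 𝔹 k).symm i).1 : ℕ) ((constrEnum 𝔹 k).symm i).2.1) : s.card ≤ constrCard 𝔹 k :=
  (Finset.card_le_univ s).trans (Fintype.card_fin _).le

end OfClass

/-! ## §5  The local count in closed form: a fine bond feeds at most `(2d)^j` bonds of level `j`, hence at most `Σ_{j ≤ k} (2d)^j` constrained bonds -/

section Count

variable {P : Params}

/-- At most `2d` positively oriented bonds have a given site as an endpoint. [cite: Balaban1985Averaging, (5) p.18 (bookkeeping)] -/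
theorem card_filter_src_eq_or_tgt_eq_le {j : ℕ} (y : Site P (j + 1)) :
    (Finset.univ.filter fun c : PBond P (j + 1) => c.src = y ∨ c.tgt = y).card ≤ 2 * P.d := by
  classical
  have h1 : (Finset.univ.filter fun c : PBond P (j + 1) => c.src = y).card ≤ P.d := by
    have hsub : (Finset.univ.filter fun c : PBond P (j + 1) => c.src = y) ⊆ (Finset.univ : Finset (Fin P.d)).image fun μ => (⟨y, μ⟩ : PBond P (j + 1)) := by
      intro c hc
      rw [Finset.mem_filter] at hc
      rw [Finset.mem_image]
      refine ⟨c.dir, Finset.mem_univ _, ?_⟩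
      obtain ⟨s, μ⟩ := c
      simp only at hc
      rw [hc.2]
    exact (Finset.card_le_card hsub).trans (Finset.card_image_le.trans (by simp))
  have h2 : (Finset.univ.filter fun c : PBond P (j + 1) => c.tgt = y).card ≤ P.d := by
    have hinj : Set.InjOn (fun c : PBond P (j + 1) => c.dir) ↑(Finset.univ.filter fun c : PBond P (j + 1) => c.tgt = y) := by
      intro c₁ hc₁ c₂ hc₂ hdir
      rw [Finset.coe_filter] at hc₁ hc₂
      have h₁ : c₁.src.shift c₁.dir = y := hc₁.2
      have h₂ : c₂.src.shift c₂.dir = y := hc₂.2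
      obtain ⟨s₁, μ₁⟩ := c₁
      obtain ⟨s₂, μ₂⟩ := c₂
      simp only at hdir h₁ h₂
      subst hdir
      have hs : s₁ = s₂ := AveragingRT.shift_injective μ₁ (h₁.trans h₂.symm)
      rw [hs]
    exact (Finset.card_le_card_of_injOn (fun c : PBond P (j + 1) => c.dir) (fun c _ => Finset.mem_univ c.dir) hinj).trans (by simp)
  calc (Finset.univ.filter fun c : PBond P (j + 1) => c.src = y ∨ c.tgt = y).card
      = ((Finset.univ.filter fun c : PBond P (j + 1) => c.src = y) ∪ (Finset.univ.filter fun c : PBond P (j + 1) => c.tgt = y)).card := by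
        rw [Finset.filter_or]
    _ ≤ (Finset.univ.filter fun c : PBond P (j + 1) => c.src = y).card + (Finset.univ.filter fun c : PBond P (j + 1) => c.tgt = y).card :=
        Finset.card_union_le _ _
    _ ≤ P.d + P.d := add_le_add h1 h2
    _ = 2 * P.d := by ring

open scoped Classical in
/-- ★ **A FINE BOND FEEDS AT MOST `(2d)^j` BONDS OF LEVEL `j`** (induction over r12's `feeds`: `feeds (j+1) c` collects the `feeds j b′` of the `j`-bonds `b′` whose source block is
an endpoint of `c`, and at most `2d` bonds share an endpoint). [cite: Balaban1988Convergent, (2.11) p.256; Balaban1987RG1, (0.4) p.253 (bookkeeping)] -/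
theorem card_filter_mem_feeds_le (b : PBond P 0) : ∀ j : ℕ, (Finset.univ.filter fun c : PBond P j => b ∈ feeds j c).card ≤ (2 * P.d) ^ j
  | 0 => by
      classical
      have h : (Finset.univ.filter fun c : PBond P 0 => b ∈ feeds 0 c) ⊆ {b} := by
        intro c hc
        rw [Finset.mem_filter, feeds_zero, Set.mem_singleton_iff] at hc
        rw [Finset.mem_singleton, hc.2]
      exact le_trans (Finset.card_le_card h) (by rw [Finset.card_singleton, pow_zero])
  | j + 1 => by
      classical
      have hsub : (Finset.univ.filter fun c : PBond P (j + 1) => b ∈ feeds (j + 1) c)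
          ⊆ (Finset.univ.filter fun b' : PBond P j => b ∈ feeds j b').biUnion
              (fun b' => Finset.univ.filter fun c : PBond P (j + 1) => c.src = blockOf b'.src ∨ c.tgt = blockOf b'.src) := by
        intro c hc
        rw [Finset.mem_filter] at hc
        obtain ⟨b', hb', hbf⟩ := mem_feeds_succ.1 hc.2
        rw [Finset.mem_biUnion]
        refine ⟨b', Finset.mem_filter.2 ⟨Finset.mem_univ _, hbf⟩, Finset.mem_filter.2 ⟨Finset.mem_univ _, ?_⟩⟩
        rcases hb' with h | h
        · exact Or.inl h.symm
        · exact Or.inr h.symm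
      calc (Finset.univ.filter fun c : PBond P (j + 1) => b ∈ feeds (j + 1) c).card
          ≤ ((Finset.univ.filter fun b' : PBond P j => b ∈ feeds j b').biUnion
              (fun b' => Finset.univ.filter fun c : PBond P (j + 1) => c.src = blockOf b'.src ∨ c.tgt = blockOf b'.src)).card := Finset.card_le_card hsub
        _ ≤ ∑ b' ∈ (Finset.univ.filter fun b' : PBond P j => b ∈ feeds j b'),
              (Finset.univ.filter fun c : PBond P (j + 1) => c.src = blockOf b'.src ∨ c.tgt = blockOf b'.src).card := Finset.card_biUnion_le
        _ ≤ ∑ _b' ∈ (Finset.univ.filter fun b' : PBond P j => b ∈ feeds j b'), 2 * P.d := Finset.sum_le_sum fun b' _ => card_filter_src_eq_or_tgt_eq_le _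
        _ = (Finset.univ.filter fun b' : PBond P j => b ∈ feeds j b').card * (2 * P.d) := by rw [Finset.sum_const, smul_eq_mul]
        _ ≤ (2 * P.d) ^ j * (2 * P.d) := Nat.mul_le_mul_right _ (card_filter_mem_feeds_le b j)
        _ = (2 * P.d) ^ (j + 1) := by ring

/-- ★★ **THE LOCAL-COUNT LETTER `hovl` IN CLOSED FORM**: every fine bond feeds at most `Σ_{j ≤ k} (2d)^j` constrained bonds of levels `≤ k` of ANY determining set — a per-height
number, independent of the torus and of the determining set. [cite: Balaban1988Convergent, (2.2) p.255, (2.11) p.256 (bookkeeping)] -/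
theorem hovl_geometric (𝔹 : DetSet P) (k : ℕ) (b : PBond P 0) (s : Finset (Fin (constrCard 𝔹 k)))
    (h : ∀ i ∈ s, b ∈ feeds (((constrEnum 𝔹 k).symm i).1 : ℕ) ((constrEnum 𝔹 k).symm i).2.1) :
    s.card ≤ ∑ j ∈ Finset.range (k + 1), (2 * P.d) ^ j := by
  classical
  let φ : Fin (constrCard 𝔹 k) → (Σ j : Fin (k + 1), PBond P j) :=
    Sigma.map id (fun _ => Subtype.val) ∘ (constrEnum 𝔹 k).symm
  have hφ : Function.Injective φ :=
    (Function.Injective.sigma_map Function.injective_id fun _ => Subtype.val_injective).comp (constrEnum 𝔹 k).symm.injective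
  let T : Finset (Σ j : Fin (k + 1), PBond P j) :=
    Finset.univ.sigma fun j : Fin (k + 1) => Finset.univ.filter fun c : PBond P j => b ∈ feeds (j : ℕ) c
  have hmaps : ∀ i ∈ s, φ i ∈ T := fun i hi =>
    Finset.mem_sigma.2 ⟨Finset.mem_univ _, Finset.mem_filter.2 ⟨Finset.mem_univ _, h i hi⟩⟩
  calc s.card ≤ T.card := Finset.card_le_card_of_injOn φ hmaps (hφ.injOn)
    _ = ∑ j : Fin (k + 1), (Finset.univ.filter fun c : PBond P j => b ∈ feeds (j : ℕ) c).card := Finset.card_sigma _ _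
    _ ≤ ∑ j : Fin (k + 1), (2 * P.d) ^ (j : ℕ) := Finset.sum_le_sum fun j _ => card_filter_mem_feeds_le b j
    _ = ∑ j ∈ Finset.range (k + 1), (2 * P.d) ^ j := Fin.sum_univ_eq_sum_range (fun j => (2 * P.d) ^ j) (k + 1)

end Count

end Summit.QuantumFields.YangMills.BalabanUVNodes.N12ChartCurvatureL1OfClass

end
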